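import Summits.HodgeConjecture.CorCM.SimpleCMSurfaceProductsHodge
import Summits.HodgeConjecture.CorCM.QuadraticCMFamiliesNonisomorphic
import Summits.HodgeConjecture.CorCM.ForeignQuadraticCMFieldsHodge
import Summits.HodgeConjecture.CorCM.QuarticCMConjugationSquare
import Literature.NumberTheory.ComplexMultiplication.CMFieldConjSquareQuadraticSubfields
import HarnessLib

/-!
# Products of CM elliptic curves and simple CM abelian surfaces: `B• = D•` on all power products iff no three of the
# CM fields share their Galois closure — the complete answer in dimension `≤ 2` per factor

COR-CM (cell `pub-hodgecm2`, binder seat `p2` gen 20), count-neutral; NEW as stated, hence under `Summits/`.  HONEST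
FRAMING: an unconditional theorem on products of CM abelian varieties of dimension `≤ 2`; not a step of the summit chain.
Sequel of `CorCM/SimpleCMSurfaceProductsHodge` (surfaces only), which it extends by imaginary quadratic slots.

For pairwise non-isogenous SIMPLE complex abelian varieties `A_i` of CM type of dimension `1` or `2` (CM elliptic curves
and simple CM surfaces; realisations of CM types `Φ_i` of CM fields `K_i` of degree `2` or `4`, closures `L_i ≤ ℂ`):
* `isNondegenerateFamily_iff_curves_simpleSurfaces` — **`(Φ_i)_i` is nondegenerate (every `∏ A_i^{a_i}` has `B• = D•`,
  `Hg(∏ A_i) = ∏ Hg(A_i)`) IFF no three pairwise distinct indices have `L_i = L_j = L_k`** (curve classes and cyclic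
  quartic classes of a nondegenerate family are even singletons: `card_normalClosure_class_le_one_of_finrank_eq_two`,
  `SimpleCMSurfaceProducts.normalClosure_ne_of_isGalois`);
* `hodgeConjectureFor_prod_curves_simpleSurfaces_of_closures` — **the Hodge conjecture, all Hodge classes polynomials in
  divisor classes, on every `⨁_{j<N} A_{π j}` as soon as no three fields share their closure** (Imai for the curves,
  Moonen–Zarhin for `≤ 2` surfaces, seats b16/b23/p2 for the mixed low cases — all special cases);
* `exists_exceptional_prod_curves_simpleSurfaces_of_closures` — an exceptional Hodge class otherwise.

PROOF.  Blocks = Galois-closure classes of ALL slots (`Pohlmann1968/CMFamilyRankPartition`: conditions only between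
PAIRS of blocks).  Distinct closures meet in totally real fields: two quartic closures (seat b23), an imaginary quadratic
field against the closure of a quartic field with a primitive type (`ℚ`; dihedral and cyclic cases), two distinct
imaginary quadratic fields (`ℚ`).  A curve class is a singleton (curves with isomorphic CM fields are CM-equivalent
slots, excluded by separation), a surface class has `≤ 2` members by hypothesis; conversely a nondegenerate family has
`Σ_{class} [K_j:ℚ] ≤ [L:ℚ]` on every class.  Theorems only; no definition, no named fact, no `sorry`.

## References
* [MoonenZarhin1999LowDim] B. Moonen, Yu. Zarhin, Math. Ann. 315 (1999) 711–733, §3 (3.1), (3.9), (4.2).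
* [Gordon1999HodgeAVSurvey] B. B. Gordon, *A survey of the Hodge conjecture for abelian varieties*, §3 Theorem (Imai,
  Murty); 7.5–7.7; 10.10.
* [Shimura1998] G. Shimura, *Abelian Varieties with Complex Multiplication and Modular Functions*, §8.4 Example (2).
* [Lang2002] S. Lang, *Algebra*, GTM 211, VI §1 Cor. 1.4, Thm. 1.14.
-/

noncomputable section

open CategoryTheory CategoryTheory.Limits NumberField NumberField.ComplexEmbedding IntermediateField Module

namespace Summit.HodgeConjecture.CorCM

open Literature.NumberTheory.ComplexMultiplication
open Literature.AlgebraicGeometry.Motives (AbelianVariety CMType)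
open Literature.AlgebraicGeometry.HodgeTheory
open Literature.AlgebraicGeometry.ComplexMultiplication (IsCMTypeRealisation isSimple_iff_isPrimitive)
open Literature.AlgebraicGeometry.VanGeemen1994 (hodgeClassSpan)
open Literature.AlgebraicGeometry.Pohlmann1968
open Literature.Barriers.HodgeConjecture (divisorClassesSpan)

namespace CMCurvesAndSurfaces

/-! ### §1 Galois closures of quadratic and quartic fields -/

section Fields

variable {I : Type} {K : I → Type} [∀ i, Field (K i)] [∀ i, NumberField (K i)] [∀ i, IsCMField (K i)]

omit [∀ i, IsCMField (K i)] in
/-- The closure in `ℂ` of an (imaginary) quadratic field is the field itself: degree `2`. [cite: Lang2002, V §3 Thm. 3.3] -/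
theorem finrank_normalClosure_eq_two (i : I) (h2 : finrank ℚ (K i) = 2) :
    finrank ℚ ↥(normalClosure ℚ (K i) ℂ) = 2 := by
  haveI : Algebra.IsQuadraticExtension ℚ (K i) := { finrank_eq_two' := h2 }
  rw [finrank_normalClosure_of_normal (K := K i), h2]

/-- The closure in `ℂ` of a quartic number field has degree at least `4` (it contains an image of the field).
[cite: Lang2002, V §3 Thm. 3.3] -/
theorem four_le_finrank_normalClosure (i : I) (h4 : finrank ℚ (K i) = 4) :
    4 ≤ finrank ℚ ↥(normalClosure ℚ (K i) ℂ) := by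
  by_cases hK : IsGalois ℚ (K i)
  · haveI := hK
    rw [finrank_normalClosure_of_normal (K := K i), h4]
  · rw [finrank_normalClosure_complex_eq_eight i h4 hK]
    norm_num

/-- A subfield of a finite extension inside `ℂ` is finite. [folklore] -/
private theorem finiteDimensional_of_le' {E E' : IntermediateField ℚ ℂ} [FiniteDimensional ℚ E] (h : E' ≤ E) :
    FiniteDimensional ℚ E' :=
  FiniteDimensional.of_injective (IntermediateField.inclusion h).toLinearMap (IntermediateField.inclusion_injective h)

/-- **Two distinct quadratic subfields of `ℂ` meet in `ℚ`** (the intersection has degree dividing `2` and is not either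
field). [cite: Lang2002, VI §1 Cor. 1.4] -/
theorem inf_eq_bot_of_finrank_eq_two_of_ne (M M' : IntermediateField ℚ ℂ) [FiniteDimensional ℚ M]
    [FiniteDimensional ℚ M'] (hM : finrank ℚ M = 2) (hM' : finrank ℚ M' = 2) (hne : M ≠ M') : M ⊓ M' = ⊥ := by
  haveI : FiniteDimensional ℚ ↥(M ⊓ M') := finiteDimensional_of_le' inf_le_left
  have hdvd : finrank ℚ ↥(M ⊓ M') ∣ 2 := hM ▸ IntermediateField.finrank_dvd_of_le_right inf_le_left
  rcases (Nat.dvd_prime Nat.prime_two).1 hdvd with h1 | h2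
  · exact IntermediateField.finrank_eq_one_iff.1 h1
  · exfalso
    have hinf : M ⊓ M' = M := IntermediateField.eq_of_le_of_finrank_eq inf_le_left (by rw [h2, hM])
    have hle : M ≤ M' := hinf ▸ inf_le_right
    exact hne (IntermediateField.eq_of_le_of_finrank_eq hle (by rw [hM, hM']))

/-- Complex conjugation fixes the rationals: `x ∈ ⊥ ⟹ x̄ = x`. [folklore] -/
private theorem conj_apply_eq_of_mem_bot {x : ℂ} (hx : x ∈ (⊥ : IntermediateField ℚ ℂ)) : starRingEnd ℂ x = x := by
  rw [IntermediateField.mem_bot] at hx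
  obtain ⟨q, rfl⟩ := hx
  rw [eq_ratCast]
  exact map_ratCast (starRingEnd ℂ) q

/-- **An imaginary quadratic field and a quartic CM field that is not biquadratic have closures meeting in `ℚ`** (the
dihedral case: seat p2's `QuarticCM.normalClosure_inf_normalClosure_eq_bot_of_not_isGalois`; the cyclic case:
`normalClosure_inf_normalClosure_eq_bot_of_isCyclic`). [cite: Lang2002, VI §1 Cor. 1.4 and Thm. 1.14] -/
theorem normalClosure_inf_normalClosure_eq_bot_of_two_of_four (i i' : I) (h2 : finrank ℚ (K i) = 2)
    (h4 : finrank ℚ (K i') = 4) (hK : ¬ (IsGalois ℚ (K i') ∧ ¬ IsCyclic (K i' ≃ₐ[ℚ] K i'))) :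
    normalClosure ℚ (K i) ℂ ⊓ normalClosure ℚ (K i') ℂ = ⊥ := by
  by_cases hgal : IsGalois ℚ (K i')
  · haveI := hgal
    haveI : IsCyclic (K i' ≃ₐ[ℚ] K i') := by_contra fun hc => hK ⟨hgal, hc⟩
    exact normalClosure_inf_normalClosure_eq_bot_of_isCyclic (K := K i') h2 (by rw [h4])
  · exact QuarticCM.normalClosure_inf_normalClosure_eq_bot_of_not_isGalois h2 h4 hgal

/-- **Distinct closures of CM fields of degree `≤ 4` (quartic ones not biquadratic) meet in totally real fields**:
complex conjugation fixes `L_i ∩ L_{i'}` pointwise whenever `L_i ≠ L_{i'}`. [cite: Lang2002, VI §1 Cor. 1.4]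
[cite: Shimura1998, §8.4 Example (2)] -/
theorem conj_apply_eq_of_normalClosure_ne {i i' : I} (hdi : finrank ℚ (K i) = 2 ∨ finrank ℚ (K i) = 4)
    (hdi' : finrank ℚ (K i') = 2 ∨ finrank ℚ (K i') = 4)
    (hKi : finrank ℚ (K i) = 4 → ¬ (IsGalois ℚ (K i) ∧ ¬ IsCyclic (K i ≃ₐ[ℚ] K i)))
    (hKi' : finrank ℚ (K i') = 4 → ¬ (IsGalois ℚ (K i') ∧ ¬ IsCyclic (K i' ≃ₐ[ℚ] K i')))
    (hne : normalClosure ℚ (K i) ℂ ≠ normalClosure ℚ (K i') ℂ) {x : ℂ} (hx : x ∈ normalClosure ℚ (K i) ℂ)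
    (hx' : x ∈ normalClosure ℚ (K i') ℂ) : starRingEnd ℂ x = x := by
  rcases hdi with h2 | h4
  · rcases hdi' with h2' | h4'
    · exact conj_apply_eq_of_mem_bot ((inf_eq_bot_of_finrank_eq_two_of_ne _ _ (finrank_normalClosure_eq_two i h2)
        (finrank_normalClosure_eq_two i' h2') hne) ▸ IntermediateField.mem_inf.2 ⟨hx, hx'⟩)
    · exact conj_apply_eq_of_mem_bot ((normalClosure_inf_normalClosure_eq_bot_of_two_of_four i i' h2 h4' (hKi' h4')) ▸
        IntermediateField.mem_inf.2 ⟨hx, hx'⟩)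
  · rcases hdi' with h2' | h4'
    · exact conj_apply_eq_of_mem_bot ((normalClosure_inf_normalClosure_eq_bot_of_two_of_four i' i h2' h4 (hKi h4)) ▸
        IntermediateField.mem_inf.2 ⟨hx', hx⟩)
    · exact conj_apply_eq_of_mem_inf_of_normalClosure_ne h4 h4' (hKi h4) (hKi' h4') hne hx hx'

omit [∀ i, IsCMField (K i)] in
/-- Two quadratic number fields with the same image in `ℂ` are isomorphic. [cite: Lang2002, V §3 Thm. 3.3] -/
theorem nonempty_ringEquiv_of_normalClosure_eq {i j : I} (h2i : finrank ℚ (K i) = 2) (h2j : finrank ℚ (K j) = 2)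
    (hL : normalClosure ℚ (K i) ℂ = normalClosure ℚ (K j) ℂ) : Nonempty (K i ≃+* K j) := by
  haveI : Algebra.IsQuadraticExtension ℚ (K i) := { finrank_eq_two' := h2i }
  haveI : Algebra.IsQuadraticExtension ℚ (K j) := { finrank_eq_two' := h2j }
  obtain ⟨si⟩ : Nonempty (K i →+* ℂ) := inferInstance
  obtain ⟨sj⟩ : Nonempty (K j →+* ℂ) := inferInstance
  have h : si.toRatAlgHom.fieldRange = sj.toRatAlgHom.fieldRange := by
    rw [← normalClosure_eq_fieldRange_of_normal si.toRatAlgHom, ← normalClosure_eq_fieldRange_of_normal sj.toRatAlgHom]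
    exact hL
  exact ⟨((AlgEquiv.ofInjectiveField si.toRatAlgHom).trans
    ((IntermediateField.equivOfEq h).trans (AlgEquiv.ofInjectiveField sj.toRatAlgHom).symm)).toRingEquiv⟩

end Fields

/-! ### §2 Type level: closure classes of a nondegenerate family of quadratic/quartic CM types -/

section Types

variable {I : Type} {K : I → Type} [∀ i, Field (K i)] [∀ i, NumberField (K i)] [∀ i, IsCMField (K i)] [Fintype I]
  [Nonempty I]

/-- **Closure bound on a closure class of a nondegenerate family**: `Σ_{L_j = L_{i₀}} [K_j:ℚ] ≤ [L_{i₀}:ℚ]` (the class is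
a block of the partition by closures, nondegenerate by `IsNondegenerateFamily.fiber`). [cite: Gordon1999HodgeAVSurvey, 7.6.1 and 7.7] -/
theorem sum_finrank_class_le_of_isNondegenerateFamily {Φ : ∀ i, CMType (K i)} (hΦ : CMAlgebra.IsNondegenerateFamily Φ)
    (i₀ : I) [Fintype {j : I // normalClosure ℚ (K j) ℂ = normalClosure ℚ (K i₀) ℂ}] :
    ∑ j : {j : I // normalClosure ℚ (K j) ℂ = normalClosure ℚ (K i₀) ℂ}, finrank ℚ (K j.1) ≤
      finrank ℚ ↥(normalClosure ℚ (K i₀) ℂ) := by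
  classical
  let κ : I → Set.range (fun i : I => normalClosure ℚ (K i) ℂ) := fun i => ⟨normalClosure ℚ (K i) ℂ, i, rfl⟩
  have hκ : Function.Surjective κ := by rintro ⟨M, i, rfl⟩; exact ⟨i, rfl⟩
  have hblock := hΦ.fiber κ hκ (κ i₀)
  have hiff : ∀ j : I, κ j = κ i₀ ↔ normalClosure ℚ (K j) ℂ = normalClosure ℚ (K i₀) ℂ := fun j => Subtype.ext_iff
  let e : {j : I // κ j = κ i₀} ≃ {j : I // normalClosure ℚ (K j) ℂ = normalClosure ℚ (K i₀) ℂ} :=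
    Equiv.subtypeEquivRight hiff
  haveI : Nonempty {j : I // κ j = κ i₀} := ⟨⟨i₀, rfl⟩⟩
  have hsum := sum_finrank_le_of_isNondegenerateFamily (Φ := fun j : {j : I // κ j = κ i₀} => Φ j.1)
    (normalClosure ℚ (K i₀) ℂ) (fun j s y => ((hiff j.1).1 j.2) ▸ apply_mem_normalClosure j.1 s y) hblock
  calc ∑ j : {j : I // normalClosure ℚ (K j) ℂ = normalClosure ℚ (K i₀) ℂ}, finrank ℚ (K j.1)
      = ∑ j : {j : I // κ j = κ i₀}, finrank ℚ (K j.1) :=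
        (Fintype.sum_equiv e (fun j => finrank ℚ (K j.1)) (fun j => finrank ℚ (K j.1)) fun _ => rfl).symm
    _ ≤ _ := hsum

/-- **A curve slot of a nondegenerate family of quadratic/quartic CM types shares its closure with no other slot**: the
class sum is `≤ [L:ℚ] = 2` and every member has degree `≥ 2`. [cite: Gordon1999HodgeAVSurvey, §3 Theorem (Imai) and 7.7] -/
theorem card_normalClosure_class_le_one_of_finrank_eq_two {Φ : ∀ i, CMType (K i)}
    (hdim : ∀ i, finrank ℚ (K i) = 2 ∨ finrank ℚ (K i) = 4) (hΦ : CMAlgebra.IsNondegenerateFamily Φ) {i₀ : I}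
    (h2 : finrank ℚ (K i₀) = 2) : Nat.card {j : I // normalClosure ℚ (K j) ℂ = normalClosure ℚ (K i₀) ℂ} ≤ 1 := by
  classical
  have hsum := sum_finrank_class_le_of_isNondegenerateFamily hΦ i₀
  rw [finrank_normalClosure_eq_two i₀ h2] at hsum
  have hge : ∀ j : {j : I // normalClosure ℚ (K j) ℂ = normalClosure ℚ (K i₀) ℂ}, 2 ≤ finrank ℚ (K j.1) :=
    fun j => by rcases hdim j.1 with h | h <;> omega
  have hcard : 2 * Fintype.card {j : I // normalClosure ℚ (K j) ℂ = normalClosure ℚ (K i₀) ℂ} ≤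
      ∑ j : {j : I // normalClosure ℚ (K j) ℂ = normalClosure ℚ (K i₀) ℂ}, finrank ℚ (K j.1) := by
    rw [mul_comm, ← smul_eq_mul, ← Finset.card_univ, ← Finset.sum_const]
    exact Finset.sum_le_sum fun j _ => hge j
  rw [Nat.card_eq_fintype_card]
  omega

/-- **A surface slot of a nondegenerate family of quadratic/quartic CM types shares its closure with at most one other
slot**: every member of its class is quartic, and `4|J| ≤ [L:ℚ] ≤ 8`. [cite: Gordon1999HodgeAVSurvey, 7.6.1 and 7.7] -/
theorem card_normalClosure_class_le_two_of_finrank_eq_four {Φ : ∀ i, CMType (K i)}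
    (hdim : ∀ i, finrank ℚ (K i) = 2 ∨ finrank ℚ (K i) = 4) (hΦ : CMAlgebra.IsNondegenerateFamily Φ) {i₀ : I}
    (h4 : finrank ℚ (K i₀) = 4) : Nat.card {j : I // normalClosure ℚ (K j) ℂ = normalClosure ℚ (K i₀) ℂ} ≤ 2 := by
  classical
  have hsum := sum_finrank_class_le_of_isNondegenerateFamily hΦ i₀
  have h8 := SimpleCMSurfaceProducts.finrank_normalClosure_le_eight i₀ h4
  have h4L := four_le_finrank_normalClosure i₀ h4
  have hge : ∀ j : {j : I // normalClosure ℚ (K j) ℂ = normalClosure ℚ (K i₀) ℂ}, 4 ≤ finrank ℚ (K j.1) := by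
    intro j
    rcases hdim j.1 with h | h
    · exfalso
      have h2L := finrank_normalClosure_eq_two j.1 h
      rw [j.2] at h2L
      omega
    · omega
  have hcard : 4 * Fintype.card {j : I // normalClosure ℚ (K j) ℂ = normalClosure ℚ (K i₀) ℂ} ≤
      ∑ j : {j : I // normalClosure ℚ (K j) ℂ = normalClosure ℚ (K i₀) ℂ}, finrank ℚ (K j.1) := by
    rw [mul_comm, ← smul_eq_mul, ← Finset.card_univ, ← Finset.sum_const]
    exact Finset.sum_le_sum fun j _ => hge j
  rw [Nat.card_eq_fintype_card]
  omega

/-- **Three pairwise distinct slots of a nondegenerate family of quadratic/quartic CM types never share their Galois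
closure.** [cite: Gordon1999HodgeAVSurvey, 7.6.1 and 7.7] -/
theorem normalClosure_ne_of_isNondegenerateFamily {Φ : ∀ i, CMType (K i)}
    (hdim : ∀ i, finrank ℚ (K i) = 2 ∨ finrank ℚ (K i) = 4) (hΦ : CMAlgebra.IsNondegenerateFamily Φ) {i j k : I}
    (hij : i ≠ j) (hjk : j ≠ k) (hik : i ≠ k) (hLij : normalClosure ℚ (K i) ℂ = normalClosure ℚ (K j) ℂ) :
    normalClosure ℚ (K j) ℂ ≠ normalClosure ℚ (K k) ℂ := by
  classical
  intro hLjk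
  have h2 : Nat.card {l : I // normalClosure ℚ (K l) ℂ = normalClosure ℚ (K k) ℂ} ≤ 2 := by
    rcases hdim k with h | h
    · exact (card_normalClosure_class_le_one_of_finrank_eq_two hdim hΦ h).trans (by norm_num)
    · exact card_normalClosure_class_le_two_of_finrank_eq_four hdim hΦ h
  rw [Nat.card_eq_fintype_card] at h2
  let a : {l : I // normalClosure ℚ (K l) ℂ = normalClosure ℚ (K k) ℂ} := ⟨i, hLij.trans hLjk⟩
  let b : {l : I // normalClosure ℚ (K l) ℂ = normalClosure ℚ (K k) ℂ} := ⟨j, hLjk⟩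
  let d : {l : I // normalClosure ℚ (K l) ℂ = normalClosure ℚ (K k) ℂ} := ⟨k, rfl⟩
  have h3 : 2 < Fintype.card {l : I // normalClosure ℚ (K l) ℂ = normalClosure ℚ (K k) ℂ} :=
    Fintype.two_lt_card_iff.2 ⟨a, b, d, fun h => hij (congrArg Subtype.val h),
      fun h => hik (congrArg Subtype.val h), fun h => hjk (congrArg Subtype.val h)⟩
  omega

end Types

/-! ### §3 CM elliptic curves and simple CM surfaces: the classification -/

section Geometry

variable {I : Type} {K : I → Type} [∀ i, Field (K i)] [∀ i, NumberField (K i)] [∀ i, IsCMField (K i)] [Fintype I]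
  [Nonempty I] {Φ : ∀ i, CMType (K i)}
variable {A : I → AbelianVariety ℂ} {ι : ∀ i, 𝓞 (K i) →+* End (A i)}
  {θ : ∀ i, K i →+* Module.End ℂ (complexBetti (A i).X 1)}

omit [Fintype I] [Nonempty I] in
/-- The quartic CM field of a simple CM abelian surface is not biquadratic. [cite: Shimura1998, §8.4 Example (2)(A)] -/
private theorem not_biquadratic (hA : ∀ i, IsCMTypeRealisation (Φ i) (A i) (ι i) (θ i)) (hS : ∀ i, (A i).IsSimple)
    (i : I) (h4 : finrank ℚ (K i) = 4) : ¬ (IsGalois ℚ (K i) ∧ ¬ IsCyclic (K i ≃ₐ[ℚ] K i)) :=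
  not_biquadratic_of_isPrimitive i h4 ((isSimple_iff_isPrimitive (hA i) (Classical.arbitrary (K i →+* ℂ))).1 (hS i))

omit [Fintype I] [Nonempty I] in
/-- **Two distinct CURVE slots of a separating family have different closures** (CM elliptic curves with isomorphic CM
fields are CM-equivalent slots). [cite: Gordon1999HodgeAVSurvey, §3 Theorem (Imai, Murty)] -/
theorem normalClosure_ne_of_finrank_eq_two (hdim : ∀ i, finrank ℚ (K i) = 2 ∨ finrank ℚ (K i) = 4)
    (hsep : CMAlgebra.IsSeparatingFamily Φ) {i j : I} (hij : i ≠ j) (h2i : finrank ℚ (K i) = 2) :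
    normalClosure ℚ (K i) ℂ ≠ normalClosure ℚ (K j) ℂ := by
  intro hL
  have h2j : finrank ℚ (K j) = 2 := by
    rcases hdim j with h | h
    · exact h
    · exfalso
      have h2L := finrank_normalClosure_eq_two i h2i
      have h4L := four_le_finrank_normalClosure j h
      rw [hL] at h2L
      omega
  obtain ⟨e⟩ := nonempty_ringEquiv_of_normalClosure_eq h2i h2j hL
  have hsep' : CMAlgebra.IsSeparatingFamily (fun l : {l : I // finrank ℚ (K l) = 2} => Φ l.1) :=
    isSeparatingFamily_subtype hsep _
  exact (isEmpty_ringEquiv_of_isSeparatingFamily (I := {l : I // finrank ℚ (K l) = 2}) (K := fun l => K l.1)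
    (fun l => l.2) hsep' (i := ⟨i, h2i⟩) (j := ⟨j, h2j⟩) (fun h => hij (congrArg Subtype.val h))).false e

/-- **Pairwise non-isogenous CM elliptic curves and simple CM abelian surfaces, no three CM fields with the same Galois
closure: the family of their CM types is NONDEGENERATE** (`Hg(∏ A_i) = ∏ Hg(A_i)`).  Blocks = closure classes (pairwise
totally real intersections); a curve class is a singleton, a surface class a single primitive quartic type or a pair of
simple non-isogenous CM surfaces. [cite: MoonenZarhin1999LowDim, §3 (3.1) and "Hodge groups of simple abelian surfaces of CM-type"]
[cite: Gordon1999HodgeAVSurvey, §3 Theorem (Imai, Murty) and 7.5] -/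
theorem isNondegenerateFamily_curves_simpleSurfaces_of_closures (hdim : ∀ i, finrank ℚ (K i) = 2 ∨ finrank ℚ (K i) = 4)
    (hA : ∀ i, IsCMTypeRealisation (Φ i) (A i) (ι i) (θ i)) (hS : ∀ i, (A i).IsSimple)
    (hniso : ∀ i j, i ≠ j → ¬ AbelianVariety.IsIsogenous (A i) (A j))
    (h3 : ∀ i j k : I, i ≠ j → j ≠ k → i ≠ k → normalClosure ℚ (K i) ℂ = normalClosure ℚ (K j) ℂ →
      normalClosure ℚ (K j) ℂ ≠ normalClosure ℚ (K k) ℂ) :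
    CMAlgebra.IsNondegenerateFamily Φ := by
  classical
  have hsep : CMAlgebra.IsSeparatingFamily Φ :=
    CMAlgebra.isSeparatingFamily_of_isSimple_of_pairwise_not_isIsogenous hA hS hniso
  let κ : I → Set.range (fun i : I => normalClosure ℚ (K i) ℂ) := fun i => ⟨normalClosure ℚ (K i) ℂ, i, rfl⟩
  have hκ : Function.Surjective κ := by rintro ⟨M, i, rfl⟩; exact ⟨i, rfl⟩
  have hiff : ∀ j i : I, κ j = κ i ↔ normalClosure ℚ (K j) ℂ = normalClosure ℚ (K i) ℂ := fun j i => Subtype.ext_iff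
  have hreal : ∀ c c', c ≠ c' → ∀ x : ℂ, x ∈ (⨆ j : {j : I // κ j = c}, normalClosure ℚ (K j.1) ℂ) →
      x ∈ (⨆ j : {j : I // κ j = c'}, normalClosure ℚ (K j.1) ℂ) → starRingEnd ℂ x = x := by
    intro c c' hcc' x hx hx'
    obtain ⟨i, rfl⟩ := hκ c
    obtain ⟨i', rfl⟩ := hκ c'
    have hne : normalClosure ℚ (K i) ℂ ≠ normalClosure ℚ (K i') ℂ := fun h => hcc' (Subtype.ext h)
    exact conj_apply_eq_of_normalClosure_ne (hdim i) (hdim i') (not_biquadratic hA hS i) (not_biquadratic hA hS i')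
      hne ((iSup_le fun j : {j : I // κ j = κ i} => le_of_eq ((hiff j.1 i).1 j.2)) hx)
      ((iSup_le fun j : {j : I // κ j = κ i'} => le_of_eq ((hiff j.1 i').1 j.2)) hx')
  refine (CMAlgebra.isNondegenerateFamily_iff_forall_fiber_of_conj_apply_eq Φ κ hκ hreal).2 fun c => ?_
  obtain ⟨i₀, rfl⟩ := hκ c
  haveI : Nonempty {j : I // κ j = κ i₀} := ⟨⟨i₀, rfl⟩⟩
  have hle2 : Fintype.card {j : I // κ j = κ i₀} ≤ 2 := by
    by_contra hlt
    obtain ⟨a, b, d, hab, had, hbd⟩ := Fintype.two_lt_card_iff.1 (not_le.1 hlt)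
    exact h3 a.1 b.1 d.1 (fun h => hab (Subtype.ext h)) (fun h => hbd (Subtype.ext h))
      (fun h => had (Subtype.ext h)) (((hiff a.1 i₀).1 a.2).trans ((hiff b.1 i₀).1 b.2).symm)
      (((hiff b.1 i₀).1 b.2).trans ((hiff d.1 i₀).1 d.2).symm)
  rcases Nat.lt_or_ge (Fintype.card {j : I // κ j = κ i₀}) 2 with hlt | hge
  · -- one slot: a quadratic type, or a primitive quartic type
    have h1 : Fintype.card {j : I // κ j = κ i₀} = 1 := le_antisymm (by omega) (Fintype.card_pos_iff.2 inferInstance)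
    obtain ⟨x, hx⟩ := Fintype.card_eq_one_iff.1 h1
    letI : Unique {j : I // κ j = κ i₀} := ⟨⟨x⟩, hx⟩
    refine (CMAlgebra.isNondegenerateFamily_iff_isNondegenerate _).2 ?_
    rcases hdim (default : {j : I // κ j = κ i₀}).1 with h2 | h4
    · exact isNondegenerate_of_finrank_eq_two _ h2
    · exact isNondegenerate_of_quartic_not_biquadratic _ h4 (not_biquadratic hA hS _ h4) _
  · -- two slots: both quartic (a curve class is a singleton), a pair of simple non-isogenous CM surfaces
    obtain ⟨x, y, hxy, hxy'⟩ := Finset.card_eq_two.1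
      (show (Finset.univ : Finset {j : I // κ j = κ i₀}).card = 2 by rw [Finset.card_univ]; omega)
    have hI : ∀ j : {j : I // κ j = κ i₀}, j = x ∨ j = y := fun j => by
      simpa [hxy'] using Finset.mem_univ j
    have hLxy : normalClosure ℚ (K x.1) ℂ = normalClosure ℚ (K y.1) ℂ :=
      ((hiff x.1 i₀).1 x.2).trans ((hiff y.1 i₀).1 y.2).symm
    have hxy1 : x.1 ≠ y.1 := fun h => hxy (Subtype.ext h)
    have h4 : ∀ j : {j : I // κ j = κ i₀}, finrank ℚ (K j.1) = 4 := by
      intro j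
      rcases hdim j.1 with h2j | h4j
      · exfalso
        rcases hI j with rfl | rfl
        · exact normalClosure_ne_of_finrank_eq_two hdim hsep hxy1 h2j hLxy
        · exact normalClosure_ne_of_finrank_eq_two hdim hsep (Ne.symm hxy1) h2j hLxy.symm
      · exact h4j
    exact isNondegenerateFamily_simpleSurfaces hxy hI h4 (fun j => hA j.1) (fun j => hS j.1)
      fun j j' hne => hniso j.1 j'.1 fun h => hne (Subtype.ext h)

/-- **THE CLASSIFICATION in dimension `≤ 2` per factor.**  For pairwise non-isogenous CM elliptic curves and simple CM
abelian surfaces `A_i` (realisations of CM types `Φ_i` of CM fields of degree `2` or `4`), the family `(Φ_i)_i` is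
nondegenerate — `B• = D•` on every power product, `Hg(∏ A_i) = ∏ Hg(A_i)` — IF AND ONLY IF no three pairwise distinct
indices have `L_i = L_j = L_k`. [cite: MoonenZarhin1999LowDim, §3 (3.1), (3.9)] [cite: Gordon1999HodgeAVSurvey, §3 and 7.5–7.7] -/
theorem isNondegenerateFamily_iff_curves_simpleSurfaces (hdim : ∀ i, finrank ℚ (K i) = 2 ∨ finrank ℚ (K i) = 4)
    (hA : ∀ i, IsCMTypeRealisation (Φ i) (A i) (ι i) (θ i)) (hS : ∀ i, (A i).IsSimple)
    (hniso : ∀ i j, i ≠ j → ¬ AbelianVariety.IsIsogenous (A i) (A j)) :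
    CMAlgebra.IsNondegenerateFamily Φ ↔
      ∀ i j k : I, i ≠ j → j ≠ k → i ≠ k → normalClosure ℚ (K i) ℂ = normalClosure ℚ (K j) ℂ →
        normalClosure ℚ (K j) ℂ ≠ normalClosure ℚ (K k) ℂ :=
  ⟨fun hΦ _ _ _ hij hjk hik => normalClosure_ne_of_isNondegenerateFamily hdim hΦ hij hjk hik,
    isNondegenerateFamily_curves_simpleSurfaces_of_closures hdim hA hS hniso⟩

/-- **The Hodge conjecture for every product `∏_j A_{π j}` of pairwise non-isogenous CM elliptic curves and simple CM
abelian surfaces, no three of whose CM fields share their Galois closure** — with `Bᵐ ⊗ ℂ = Dᵐ ⊗ ℂ` in every degree,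
UNCONDITIONALLY, any number of factors and multiplicities. [cite: MoonenZarhin1999LowDim, §3 (3.1) and Cor. (3.9)]
[cite: Gordon1999HodgeAVSurvey, §3 Theorem (Imai, Murty), 7.5 and 10.10] -/
theorem hodgeConjectureFor_prod_curves_simpleSurfaces_of_closures
    (hdim : ∀ i, finrank ℚ (K i) = 2 ∨ finrank ℚ (K i) = 4)
    (hA : ∀ i, IsCMTypeRealisation (Φ i) (A i) (ι i) (θ i)) (hS : ∀ i, (A i).IsSimple)
    (hniso : ∀ i j, i ≠ j → ¬ AbelianVariety.IsIsogenous (A i) (A j))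
    (h3 : ∀ i j k : I, i ≠ j → j ≠ k → i ≠ k → normalClosure ℚ (K i) ℂ = normalClosure ℚ (K j) ℂ →
      normalClosure ℚ (K j) ℂ ≠ normalClosure ℚ (K k) ℂ) {N : ℕ} (π : Fin N → I) :
    HodgeConjectureFor (⨁ fun j : Fin N => A (π j)).dim (⨁ fun j : Fin N => A (π j)).X ∧
      ∀ m : ℕ, hodgeClassSpan (⨁ fun j : Fin N => A (π j)).dim (⨁ fun j : Fin N => A (π j)).X m =
        divisorClassesSpan (⨁ fun j : Fin N => A (π j)).X (⨁ fun j : Fin N => A (π j)).dim m :=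
  have hnd := isNondegenerateFamily_curves_simpleSurfaces_of_closures hdim hA hS hniso h3
  ⟨hnd.hodgeConjectureFor_prod hA π, fun m => hnd.hodgeClassSpan_prod_eq_divisorClassesSpan hA π m⟩

/-- **Conversely**: three pairwise non-isogenous simple CM abelian varieties of dimension `≤ 2` whose CM fields share
their Galois closure (necessarily three surfaces of one dihedral closure) force an exceptional Hodge class on some
product of the family. [cite: Gordon1999HodgeAVSurvey, 7.5 and §9.2] -/
theorem exists_exceptional_prod_curves_simpleSurfaces_of_closures
    (hdim : ∀ i, finrank ℚ (K i) = 2 ∨ finrank ℚ (K i) = 4)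
    (hA : ∀ i, IsCMTypeRealisation (Φ i) (A i) (ι i) (θ i)) (hS : ∀ i, (A i).IsSimple)
    (hniso : ∀ i j, i ≠ j → ¬ AbelianVariety.IsIsogenous (A i) (A j)) {i j k : I} (hij : i ≠ j) (hjk : j ≠ k)
    (hik : i ≠ k) (hLij : normalClosure ℚ (K i) ℂ = normalClosure ℚ (K j) ℂ)
    (hLjk : normalClosure ℚ (K j) ℂ = normalClosure ℚ (K k) ℂ) :
    ∃ (N : ℕ) (π : Fin N → I) (m : ℕ) (c : complexBetti (⨁ fun l : Fin N => A (π l)).X (2 * m)),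
      IsRationalClass c ∧
      IsOfHodgeType (⨁ fun l : Fin N => A (π l)).dim (⨁ fun l : Fin N => A (π l)).X (2 * m) m m c ∧
      c ∉ divisorClassesSpan (⨁ fun l : Fin N => A (π l)).X (⨁ fun l : Fin N => A (π l)).dim m :=
  CMAlgebra.exists_exceptional_prod_of_not_isNondegenerateFamily
    (CMAlgebra.isSeparatingFamily_of_isSimple_of_pairwise_not_isIsogenous hA hS hniso)
    (fun hΦ => normalClosure_ne_of_isNondegenerateFamily hdim hΦ hij hjk hik hLij hLjk) hA

end Geometry

end CMCurvesAndSurfaces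

end Summit.HodgeConjecture.CorCM

end
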